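import Literature.NumberTheory.ConnesConsani2021.SpectralCertCheck
import Literature.NumberTheory.ConnesConsani2021.TraceRemainderEpsilon
import HarnessLib

/-!
# Connes–Consani 2021 §5–§6 — the ONE numerical input of the archimedean certificate, and its exports

LABEL (line 1): RH-FREE.  One named numerical fact about CC's density `ε ∘ exp` (its `C²` extensions
`G`, `IsArchDensity G`): (i) the certified `L¹` enclosure `∫_{−log 2}^{log 2} |τ_c − ϖ_G| ≤ ε₁` of the
kernel `ϖ_G` of `𝐊_I` (Prop. 5.5 (ii); `JumpFormula.varpi`) by the certificate's trigonometric kernel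
`τ_c` (`SpectralCert.frameKernel`, data `SpectralCert.CertAF`), replacing CC's Fact 6.1
(`ε₁ ≈ 0.00122` for THEIR 1732-term kernel; ours: `ε₁ = 1/400` for `N = 100` half-integer modes), and
(ii) = (E-b) the enclosure `22.9 ≤ Σ t(n) ≤ 23.1` of the prolate slope series (Lemma 5.4 prints `ε′(1₊) ≃ 22.9965`;
in-house certified `22.99647568387052 ≤ Σ t(n) ≤ 22.99647568387054`), VERBATIM the `henc` binder of t5's `densitySlope_of_lemma_5_4`.
NUMERICAL-CERTIFIED-EXTERNAL (interval arithmetic in two code-disjoint lineages, cc/engine; not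
kernel arithmetic) — hence a named fact `def … : Prop`, never discharged here; uniform in `G` and
ONE-SIDED as ruled (cc-lead R17/R26).  Exports: the route binders' shapes K3
(`windowSpectralBound_of_section6Enclosures`, via the kernel-checked certificate
`SpectralCert.windowSpectralBound_of_L1`) and K2 (`densitySlope_of_section6Enclosures`, which also takes the ANALYTIC `CC2021_lemma_5_4`), both over
`IsArchDensity` (t4, `ArchimedeanTraceFormula.lean`); the route file's inline density predicate is
transported to `IsArchDensity` by cc-iso's `Theorems/CCRouteAdapters.lean` (O9), not here (Literature
never imports the route).  Nothing here is RH-detecting; nothing here bears on the truth of RH.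
[bears_on: W-C/W-P; A. Connes, C. Consani, Selecta Math. 27 (2021) 77 = arXiv:2006.13771, bib
`ConnesConsani2021`.]

WHAT THIS FILE IS NOT: a kernel proof of the two enclosures (GAP G-cc-5: prolate enclosures `ψ_{2n}`,
`n ≤ 11`, in kernel interval arithmetic would discharge `CC2021_section6_enclosures`); not a statement
about `ζ`.
-/

noncomputable section

open MeasureTheory Set
open scoped InnerProductSpace Real

namespace Literature.NumberTheory.ConnesConsani2021

open Literature.NumberTheory.LFunctions

namespace SpectralCert

/-- RH-FREE. **The analytic input (E-a) of the Route A-F certificate for a density `G`**: `L¹` kernel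
approximation on the doubled window, `∫_{[−log 2, log 2]} |τ_c(v) − ϖ_G(v)| dv ≤ ε₁`, with the certificate's
`τ_c = frameKernel (−½log 2) (½log 2) N c` and `ε₁ = 1/400` (`SpectralCert.CertAF`), `ϖ_G = varpi G`
(so that `‖𝐊_I − windowOp τ_c‖ ≤ ε₁` by Lemma 6.3 — the role CC's Fact 6.1 plays for their own kernel).
[cite: ConnesConsani2021, §6.4 Fact 6.1 + Lemma 6.3 p. 24 (ε₁); §5 Lemma 5.4 p. 20 (ε′(1₊) ≃ 22.9965); certificate cc/engine cert-AF.json sha16 13b5d9ac82a0b8c8 (kernel-time variant cert-AF-0025-t7.json sha16 c9b33fffc99c81ac)] -/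
def AnalyticInputValid (G : ℝ → ℂ) : Prop :=
  ∫ v in Icc (-Real.log 2) (Real.log 2),
      ‖frameKernel (-(Real.log 2 / 2)) (Real.log 2 / 2) CertAF.N (fun n ↦ (CertAF.c n : ℝ)) v - varpi G v‖
        ≤ ((CertAF.ε₁ : ℚ) : ℝ)

end SpectralCert

/-- RH-FREE; NUMERICAL (external interval arithmetic, two lineages, cc-eng-1 STEP-2); one-sided (R17);
never `= float`; SUPERSEDED-BY-KERNEL-ENCLOSURE if later certified in Lean.  **The §5–§6 enclosures for
CC's archimedean density** = (E-a) ∧ (E-b):  (E-a) for every `C²` function `G` agreeing on `[0, ∞)`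
with the prolate series `x ↦ ε(eˣ)` of Thm. 4.7 (`IsArchDensity G`), `SpectralCert.AnalyticInputValid G`,
i.e. `∫_{−log 2}^{log 2} |τ_c − ϖ_G| ≤ ε₁ = 1/400` for the certificate kernel of `SpectralCert.CertAF`
(`N = 100` half-integer modes; `ϖ_G(v) = (QG)(|v|)/(2G′(0))` depends on `G` only through the prolate
series, so the clause is uniform in `G`); (E-b) VERBATIM the enclosure hypothesis `henc` of
`densitySlope_of_lemma_5_4` (`TraceRemainderEpsilon.lean`), a statement about Slepian's prolate data
alone: for the (unique) even prolate family `ψ`, `22.9 ≤ Σ' n, epsSlopeTerm (ψ n) ≤ 23.1` (Lemma 5.4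
prints `ε′(1₊) = Σ t(n) ≃ 22.9965 = 11.9719 + 8.77574 + 2.20528 + 0.0433983 + 0.000125459 + …`;
in-house certified `22.99647568387052 ≤ Σ t(n) ≤ 22.99647568387054`).  STATUS: certified OUTSIDE the kernel
(cc/engine: ε₁ ≤ 1/400 certified in TWO code-disjoint interval lineages by cc-eng-1: C (Arb/python-flint: Frobenius-shooting prolates, degree-64 Chebyshev enclosure of φ₁₁ + Markov bound, 16384-panel Taylor form) ε₁^C = 7.70674094915276·10⁻⁴ ± 3·10⁻²⁰ (job j250680, eps1C.json sha16 ba29ee8502f69576) and D (mpmath.iv per-panel Taylor jets, 4096 panels) ε₁^D ≤ 7.82924·10⁻⁴ (jobs j251104–j251107, lineageD_final.json sha16 1d57139b5f990b88); shared inputs only the coefficient table c_dyadic.json (sha16 8ba57914ee9658d6 = `SpectralCert.CertAF.cTable`, checked 101/101) and the App. F Lemma 49 (ii) tail; e′ = Σ_{n≤10} t(n) = 22.99647568387052967917068081067575 ± 2·10⁻³² (lineages A/B/C/D agree), tail Σ_{n≥11} < 10⁻³⁰; ε₁ of record 1/400 and cert of record cert-AF.json sha16 13b5d9ac82a0b8c8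 (cc-lead R40); kernel-time variant cert-AF-0025-t7.json sha16 c9b33fffc99c81ac used in SpectralCertCheck.lean; t7 float re-derivation from the posted data: 2∫₀¹|σ−P| = 7.651·10⁻⁴; certificate cc/engine cert-AF.json sha16 13b5d9ac82a0b8c8 (kernel-time variant cert-AF-0025-t7.json sha16 c9b33fffc99c81ac)); the analytic identity
`G′(0) = Σ t(n)` is NOT part of this fact (it is `CC2021_lemma_5_4`, t5).  A kernel discharge needs
certified enclosures of the prolate functions `ψ_{2n}`, `n ≤ 12`, and of `ϖ` (cell gap G-cc-5).
WHAT THIS IS NOT: RH-detecting; a claim about `ζ`; nothing here bears on the truth of RH.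
[cite: ConnesConsani2021, §6.4 Fact 6.1 + Lemma 6.3 p. 24 (ε₁); §5 Lemma 5.4 p. 20 (ε′(1₊) ≃ 22.9965); certificate cc/engine cert-AF.json sha16 13b5d9ac82a0b8c8 (kernel-time variant cert-AF-0025-t7.json sha16 c9b33fffc99c81ac)] -/
def CC2021_section6_enclosures : Prop :=
  (∀ G : ℝ → ℂ, ContDiff ℝ 2 G → IsArchDensity G → SpectralCert.AnalyticInputValid G) ∧
    (∀ ψ : ℕ → ℝ → ℝ, (∀ n, IsProlateFunction 1 (2 * n) (ψ n)) →
      (22.9 : ℝ) ≤ ∑' n, epsSlopeTerm (ψ n) ∧ ∑' n, epsSlopeTerm (ψ n) ≤ 23.1)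

/-- RH-FREE. **Export, K3 shape** (`WindowSpectralBound` over `IsArchDensity`): from the enclosures, for
every `C²` archimedean density `G` some `a₀ ∈ [0, 0.0635]` (namely `127/2000`) gives
`0 ≤ re⟪ξ, ξ − 𝐊_I ξ⟫ + a₀|⟪η₀, ξ⟫|²` on `L²([−½log 2, ½log 2])` — the kernel-checked certificate
`SpectralCert.windowSpectralBound_of_L1` fed with enclosure (i).
[cite: ConnesConsani2021, §6.7 Lemma 6.10 / Thm. 6.11 p. 28; certificate cc/engine cert-AF.json sha16 13b5d9ac82a0b8c8 (kernel-time variant cert-AF-0025-t7.json sha16 c9b33fffc99c81ac)] -/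
theorem windowSpectralBound_of_section6Enclosures (h : CC2021_section6_enclosures)
    (G : ℝ → ℂ) (hG : ContDiff ℝ 2 G) (hd : IsArchDensity G) :
    ∃ a₀ : ℝ, 0 ≤ a₀ ∧ a₀ ≤ 0.0635 ∧
      ∀ ξ : Lp ℂ 2 (volume.restrict (Icc (-(Real.log 2 / 2)) (Real.log 2 / 2))),
        0 ≤ RCLike.re ⟪ξ, ξ - windowOp (-(Real.log 2 / 2)) (Real.log 2 / 2) (integrableOn_varpi hG _ _) ξ⟫_ℂ
          + a₀ * ‖⟪constVector (-(Real.log 2 / 2)) (Real.log 2 / 2), ξ⟫_ℂ‖ ^ 2 :=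
  SpectralCert.windowSpectralBound_of_L1 G hG (h.1 G hG hd)

/-- RH-FREE. **Export, K2 shape** (`DensitySlope` over `IsArchDensity`): given the ANALYTIC Lemma 5.4
(`CC2021_lemma_5_4`: `ε` has right derivative `Σ t(n)` at `1`), enclosure (E-b) gives `G′(0)` real with
`22.9 ≤ G′(0) ≤ 23.1` for every `C²` archimedean density — t5's `densitySlope_of_lemma_5_4` fed with (E-b).
[cite: ConnesConsani2021, §5 Lemma 5.4 p. 20; certificate cc/engine cert-AF.json sha16 13b5d9ac82a0b8c8 (kernel-time variant cert-AF-0025-t7.json sha16 c9b33fffc99c81ac)] -/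
theorem densitySlope_of_section6Enclosures (h4 : CC2021_lemma_5_4) (h : CC2021_section6_enclosures) :
    ∀ G : ℝ → ℂ, ContDiff ℝ 2 G → IsArchDensity G →
      (deriv G 0).im = 0 ∧ (22.9 : ℝ) ≤ (deriv G 0).re ∧ (deriv G 0).re ≤ 23.1 :=
  densitySlope_of_lemma_5_4 h4 h.2

/-- RH-FREE. **Export, assembled data for `MainInequalityAssembly`**: with the analytic Lemma 5.4, the
enclosures give `(a₀, e′) = (127/2000, G′(0))`, `e′` real and positive, `8·a₀·e′/log 2 < 17`
(`8 · 0.0635 · 23.1 / 0.6931 < 16.94`) and the operator inequality `hpos` — exactly the hypotheses `hGe`,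
`he'`, `hpos`, `hc` of `weilArchPositivity_soninTrace_fine_of_opIneq` (the trace-formula input `hTr` is
separate: K1).  [cite: ConnesConsani2021, §6.7 Thm. 6.11 pp. 28–29; certificate cc/engine cert-AF.json sha16 13b5d9ac82a0b8c8 (kernel-time variant cert-AF-0025-t7.json sha16 c9b33fffc99c81ac)] -/
theorem opIneq_data_of_section6Enclosures (h4 : CC2021_lemma_5_4) (h : CC2021_section6_enclosures)
    (G : ℝ → ℂ) (hG : ContDiff ℝ 2 G) (hd : IsArchDensity G) :
    deriv G 0 = (((deriv G 0).re : ℝ) : ℂ) ∧ 0 < (deriv G 0).re ∧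
      (∀ ξ : Lp ℂ 2 (volume.restrict (Icc (-(Real.log 2 / 2)) (Real.log 2 / 2))),
        0 ≤ RCLike.re ⟪ξ, ξ - windowOp (-(Real.log 2 / 2)) (Real.log 2 / 2) (integrableOn_varpi hG _ _) ξ⟫_ℂ
          + (127 / 2000 : ℝ) * ‖⟪constVector (-(Real.log 2 / 2)) (Real.log 2 / 2), ξ⟫_ℂ‖ ^ 2) ∧
      8 * (127 / 2000 : ℝ) * (deriv G 0).re / Real.log 2 < 17 := by
  obtain ⟨him, hlo, hhi⟩ := densitySlope_of_lemma_5_4 h4 h.2 G hG hd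
  have h1 := h.1 G hG hd
  have hw : Icc (-(Real.log 2 / 2) - Real.log 2 / 2) (Real.log 2 / 2 - -(Real.log 2 / 2))
      = Icc (-Real.log 2) (Real.log 2) := by
    congr 1 <;> ring
  have hlog : (0.6931471803 : ℝ) < Real.log 2 := Real.log_two_gt_d9
  refine ⟨Complex.ext (by simp) (by simp [him]), by linarith, fun ξ ↦ ?_, ?_⟩
  · have := SpectralCert.opIneq_of_certAF G hG (by rw [hw]; exact h1) ξ
    norm_num [SpectralCert.CertAF.a₀] at this ⊢
    exact this
  · rw [div_lt_iff₀ (by linarith)]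
    nlinarith

end Literature.NumberTheory.ConnesConsani2021

end
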